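import Summits.ValiantsHypothesis.ValiantsHypothesis.Theorems.BarrierLeverChowThinRowsSubcubeBasis

/-!
# Route BarrierLever — item `ChowHitsThinRowPartitionMinors` (stmt-ValiantsHypothesis-20195):
# packaging a Finset-indexed family of affine forms plus extra pure factors into `h + h` slots

Helper file (`--supports stmt-ValiantsHypothesis-20195`; cell valiant-natproofs, rung V4, 𝒟-side of
door (c); prover seat val-np-p8 gen 2).  Closes NO item; imports prover g10's `…ChowThinRowsSubcubeBasis`
(pattern of `exists_forms_of_card_le`); no route file, no definitions.

* `exists_forms_of_card_le_pair` — forms `φ V`, `V ∈ PT`, together with the pure factors `1 + y_c`,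
  `c ∈ D`, `|PT| + |D| ≤ h + h`, are (after padding with the constant form `1`) a product of `h + h`
  affine forms.  Used by the doubled designs (`…ChowThinRowsBallColumns`).

WHAT THIS IS NOT: bookkeeping only; nothing on items 20195 / 20172 / 19717, on crux
stmt-ValiantsHypothesis-14610, or on `VP` versus `VNP`.
-/

set_option linter.dupNamespace false

namespace Summit.ValiantsHypothesis.ValiantsHypothesis.Theorems.BarrierLever.ChowSubcube

open Finset MvPolynomial

variable {h : ℕ}

/-- Packaging: a Finset-indexed family of indicator forms together with extra pure factors `1 + y_c`,
`c ∈ D`, at most `h + h` forms in total, is a product of `h + h` affine forms (padding with `1`). -/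
theorem exists_forms_of_card_le_pair (PT : Finset (Finset (Fin h))) (D : Finset (Fin h))
    (hcard : PT.card + D.card ≤ h + h)
    (φ : Finset (Fin h) → MvPolynomial (Fin (h + h)) ℂ) (hφ : ∀ V ∈ PT, (φ V).totalDegree ≤ 1) :
    ∃ ℓ : Fin (h + h) → MvPolynomial (Fin (h + h)) ℂ, (∀ k, (ℓ k).totalDegree ≤ 1) ∧
      ∏ k, ℓ k = (∏ V ∈ PT, φ V) * ∏ c ∈ D, (C 1 + X (Fin.natAdd h c)) := by
  classical
  let ι := PT ⊕ D
  let F : ι → MvPolynomial (Fin (h + h)) ℂ := fun x => match x with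
    | Sum.inl V => φ V
    | Sum.inr c => C 1 + X (Fin.natAdd h c)
  have hc : Fintype.card ι ≤ Fintype.card (Fin (h + h)) := by
    rw [Fintype.card_sum, Fintype.card_coe, Fintype.card_coe, Fintype.card_fin]; exact hcard
  obtain ⟨e⟩ := Function.Embedding.nonempty_of_card_le hc
  refine ⟨fun k => ∏ x ∈ (Finset.univ : Finset ι) with e x = k, F x, ?_, ?_⟩
  · intro k
    by_cases hk : ∃ x : ι, e x = k
    · obtain ⟨x, hx⟩ := hk
      have hfil : ((Finset.univ : Finset ι).filter fun x' => e x' = k) = {x} := by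
        ext x'
        simp only [Finset.mem_filter, Finset.mem_univ, true_and, Finset.mem_singleton]
        exact ⟨fun e' => e.injective (e'.trans hx.symm), fun e' => by subst e'; exact hx⟩
      simp only [hfil, Finset.prod_singleton]
      rcases x with V | c
      · exact hφ _ V.2
      · show (C 1 + X (Fin.natAdd h (c : Fin h)) : MvPolynomial (Fin (h + h)) ℂ).totalDegree ≤ 1
        refine (totalDegree_add _ _).trans (max_le ?_ ?_)
        · rw [totalDegree_C]; exact Nat.zero_le _
        · rw [totalDegree_X]
    · have hfil : ((Finset.univ : Finset ι).filter fun x' => e x' = k) = ∅ := by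
        ext x'
        simp only [Finset.mem_filter, Finset.mem_univ, true_and, Finset.notMem_empty, iff_false]
        exact fun e' => hk ⟨x', e'⟩
      simp only [hfil, Finset.prod_empty, totalDegree_one]
      exact Nat.zero_le _
  · rw [Finset.prod_fiberwise Finset.univ e F, Fintype.prod_sum_type]
    simp only [F]
    rw [Finset.prod_coe_sort PT φ, Finset.prod_coe_sort D (fun c => C 1 + X (Fin.natAdd h c))]

end Summit.ValiantsHypothesis.ValiantsHypothesis.Theorems.BarrierLever.ChowSubcube
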